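import Literature.NumberTheory.Rogawski1990.Ch12Sec5Inputs                           -- ★ TR carpet (TR-t03): the (S-𝔇) SOCKETS `EllipticData.{WeylDensity, EllCartanAE, LdsCardTwo, LdsElliptic, L2UpOnTorus, L2CharOnTorusAll, PacketInnerDefined}`; brings ★ `Ch12Sec5` (`InnerGDefined`, `InnerHDefined`), ★ `Ch12Sec5Defs`, ★ `IsLocSmooth` ∕ `isLocSmooth_indicator`
import Summits.HodgeConjecture.HodgeConjecture.Theorems.F0P3cStCharTSSaRegroupKinds  -- ★ (LH6-p01) «Sa-REGROUP KINDS»: `isEllipticPair_symm`; brings ★ p848548 «SC-FIN» (LH6-p05) `innerG_eq_zero_of_not_isEllipticRep`, ★ p848270∕p848283 «ELL-LIN» (LH6-p01) `integrable_innerG_integrand`, ★ TR carpet `Ch12Sec6` (`Prop1261c` [Prop. 12.6.1 (c) p. 188])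
import Literature.NumberTheory.Rogawski1990.CMLocalAPacketMembers                    -- ★ `Gqs` (`U(Φ₃)(L⁺_v)`, the quasi-split model)
import Literature.NumberTheory.Rogawski1990.LocalTransferGlueCM                      -- ★ `totallyDisconnectedSpace_cmDatum_local`; brings ★ instances `locallyCompactSpace_cmDatum_local`, `t2Space_cmDatum_local`
import Literature.Topology.LocallyConstantExtend                                     -- ★ `exists_isCompact_isOpen_mem_subset` (compact open neighbourhood basis)
import HarnessLib

/-!
# F0 · P3c · line LH6 «StCharTS» — brick «SOCKETS-OUT★» for the (S-𝔇) package `stub_EllipticPackage`: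
# PRINTED-INPUT SOCKETS DERIVED FROM THE PACKAGE'S OTHER CONJUNCTS — (LDSE) `LdsElliptic`, (DENS) `WeylDensity`, the `G`-half of (DEF) `PacketInnerDefined`, the `H^e` clause of (M1H)

Cell `hodgecm-mathlib`, crux `H413` (`stmt-HodgeConjecture-24833`), line LH6 `Cruxes/H413/Lines/F0_P3c_StCharTSPaydown.lean` (organ (S-𝔇) `stub_EllipticPackage`: an
existential over a §12.5 datum `𝔇 : Ch12Sec5.EllipticData (U(Φ₃)(L⁺_v)) (H_v)` with 55 conjuncts, among them the nineteen SOCKETS of ★ `Ch12Sec5Inputs` — printed inputs no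
carpet states).  Seat LH6-p02 (g4); THEOREMS ONLY (no `def`, no named fact, no `instance`, no notation, no `sorry`; axioms ⊆ {propext, Classical.choice, Quot.sound});
`--supports stmt-HodgeConjecture-24833 --as helper`.
HONEST LABEL: HC_CM is proved only modulo the 7 printed citations (2 remaining: hLiu418 = stmt-HodgeConjecture-24832, h413 = stmt-HodgeConjecture-24833) until rung 0
closes; this file is count-neutral — it lets a later leaf edition DELETE the socket (LDSE), REPLACE the analytic socket (DENS) by the definition-level coherence
«(E⊆R) `𝔇.ellG ⊆ 𝔇.regG`» ([Rogawski1990, §12.5 p. 184]: «`G^e ⊆ G^r`, the elliptic regular elements»), and RE-LETTER (DEF) to its `H`-half (DEF-H).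

THE MATHEMATICS (all elementary; every numbered statement of print enters only as the ★ carpet RELATION it is consumed from).
* §1 (generic) **two locally constant densities with the same integrals against `C_c^∞` agree pointwise.**  `X` locally compact, Hausdorff, totally disconnected,
  `μ` a Borel measure finite on compacts and positive on opens; `F, U : X → ℂ` both locally constant AT `x` and `∫ φ·F dμ = ∫ φ·U dμ` for every `φ ∈ C_c^∞(X)` (★
  `IsLocSmooth`).  Test against `𝟙_W` for a compact open `W ∋ x` on which `F ≡ F x`, `U ≡ U x` (★ `exists_isCompact_isOpen_mem_subset`): `μ(W)·F x = μ(W)·U x`,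
  `μ(W) ∈ (0, ∞)` ⇒ `F x = U x`.  (The device of ★ `F0P3cStCharTSClassFn` §1, [Rogawski1990, §1.6 pp. 5–6; §12.5 p. 182 «locally constant function on `G^r`»].)
* §2 **(DENS) ★ `EllipticData.WeylDensity` DERIVED** for any datum on a locally compact Hausdorff totally disconnected group whose `dg` is finite on compacts and
  positive on opens (e.g. `𝔇.μG = νQv` a Haar measure on `U(Φ₃)(L⁺_v)`): two measurable locally integrable functions locally constant on `G^r` with equal integrals
  against `C_c^∞(G)` agree at EVERY point of `G^r` (§1), hence `dγ`-a.e. on every elliptic Cartan representative `T ∈ cartanG` as soon as `dγ`-a.e. `γ ∈ T` is regular —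
  which is (C2) ★ `EllCartanAE` («`dγ`-a.e. `γ ∈ G^e`») together with «`G^e ⊆ G^r`» [§12.5 p. 184].  `weylDensity_of_ae_mem_regG`, `weylDensity_of_ellCartanAE`; the organ
  instance on `Gqs L v` with `𝔇.μG = νQv`: `weylDensity_gqs_of_ellCartanAE`.
* §3 **(LDSE) ★ `EllipticData.LdsElliptic` DERIVED from ★ `Ch12Sec6.Prop1261c` + (LDS2) ★ `LdsCardTwo` + (C2) ★ `EllCartanAE`** [Rogawski1990, §12.6 Prop. 12.6.1 (c)
  p. 188; §12.2 (3) p. 174; §12.5 p. 184]: if `χ_π ≡ 0` on `G^e` then by (C2) every integrand `D_G² χ_π \overline{β}` of `⟨χ_π, β⟩_{G,e}` (★ `innerG`) vanishes `dγ`-a.e. on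
  every `T ∈ cartanG`, so `⟨χ_π, β⟩_e = 0` (★ «SC-FIN» `innerG_eq_zero_of_not_isEllipticRep`); contrapositively `⟨χ_π, β⟩_e ≠ 0 ⇒ π` elliptic (`isEllipticRep_of_innerG_ne_zero`).  For an
  l.d.s. packet `Π = {π¹, π²}` ((LDS2): exactly two members) `{π¹, π²}` is an ★ `IsEllipticPair` (first kind), and Prop. 12.6.1 (c) — typed in ★ `Ch12Sec6.Prop1261c` for
  EVERY pair of distinct classes of one of the three kinds, with no ellipticity hypothesis — gives `⟨χ_{π¹}, χ_{π²}⟩_e = −1 ≠ 0`; hence both members are elliptic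
  (`isEllipticRep_of_isEllipticPair`, `ldsElliptic_of_prop1261c`).  (Print p. 187: «All representations of this type are in fact elliptic».)
* §4 **the `G`-half of (DEF) ★ `PacketInnerDefined` DERIVED from (U2) ★ `L2UpOnTorus`** (and `InnerGDefined χ_π χ_{π′}` from (L2D∀) ★ `L2CharOnTorusAll`): the integrand
  `D_G² α \overline{α′} = (D_G α)·\overline{(D_G α′)}` (`D_G` real) is integrable for `D_G α, D_G α′ ∈ L²(T, dγ)` — Cauchy–Schwarz, ★ «ELL-LIN» `integrable_innerG_integrand`
  [§12.5 p. 184; L. 12.7.2 proof p. 193 «bounded elliptic norm»].  `innerGDefined_of_memLp`, `innerGDefined_up_of_l2UpOnTorus`, `innerGDefined_char_of_l2CharOnTorusAll`,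
  `packetInnerDefined_of_l2UpOnTorus_of_innerHDefined` ((DEF) ⟸ (U2) ∧ (DEF-H)).
* §5 **(M1H)'s fourth clause «`χ_ρ` stable class function on `H^e`» DERIVED from its third («on `H^r`») and «`H^e ⊆ H^r`»** [§12.5 pp. 183–184]:
  `isClassFunOn_mono`, `isStableClassFunOn_mono`, `packetCharHRegularity_of_regH` ((M1H) ⟸ (M1H)⁻ ∧ (E⊆R)_H).

LEAF EFFECT (for the integrator, a later ED. of `Cruxes/H413/Lines/F0_P3c_StCharTSPaydown.lean`): at the (S-a) call of ★ `…SaHeadTorus7∕8` the binder `hLdsE` becomes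
`(ldsElliptic_of_prop1261c 𝔇 h61c hLds2 hTell)`; at the (S-b1)∕(S-b2) calls of ★ «ELL-COMPOSE»∕«SGN-COMPOSE» the binder `hDens` becomes
`(weylDensity_gqs_of_ellCartanAE L v νQv 𝔇 hμG hTell hER)` with `hER : 𝔇.ellG ⊆ 𝔇.regG` the new (E⊆R) conjunct, and `hDef` becomes
`(packetInnerDefined_of_l2UpOnTorus_of_innerHDefined 𝔇 hUdom hDefH)` with `hDefH` the (DEF-H) conjunct `∀ ρ ∈ 𝔇.sqPacketsH, 𝔇.InnerHDefined (𝔇.packetCharH ρ) (𝔇.packetCharH ρ)`.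

## References
* [Rogawski1990] J. D. Rogawski, *Automorphic Representations of Unitary Groups in Three Variables*, Ann. of Math. Stud. 123 (1990): §1.6 pp. 5–6; §12.2 (3) p. 174;
  §12.5 pp. 182–184; §12.6 Prop. 12.6.1 (c) pp. 187–188; §12.7 Lemma 12.7.2 (proof) pp. 192–194.
* [DeitmarEchterhoff2014] A. Deitmar, S. Echterhoff, *Principles of Harmonic Analysis*, 2nd ed. (2014): Thm. 1.5.3 (here only Cauchy–Schwarz in `L²`, via Mathlib
  `MemLp.integrable_mul`).
-/

set_option autoImplicit false
-- the mandated namespace has the single-problem summit's repeated segment (`HodgeConjecture.HodgeConjecture`)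
set_option linter.dupNamespace false

noncomputable section

open MeasureTheory Filter Topology
open NumberField IsDedekindDomain
open Literature.NumberTheory.Automorphic Literature.NumberTheory.Automorphic.UnitaryGroup Literature.NumberTheory.Rogawski1990

namespace Summit.HodgeConjecture.HodgeConjecture.Cruxes.H413.F0P3cStCharTSSocketsOut

/-! ## §1 Generic: locally constant densities with equal integrals against `C_c^∞` agree pointwise -/

section Density

universe u

variable {X : Type u} [TopologicalSpace X] [LocallyCompactSpace X] [T2Space X] [TotallyDisconnectedSpace X]
  [MeasurableSpace X] [OpensMeasurableSpace X]

/-- **Two densities locally constant at `x` with the same integrals against `C_c^∞(X)` agree at `x`.**  `X` locally compact Hausdorff totally disconnected, `μ`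
finite on compacts and positive on opens (e.g. a Haar measure); `F ≡ F x` and `U ≡ U x` near `x`; `∫ φ·F dμ = ∫ φ·U dμ` for all `φ ∈ C_c^∞(X)` (★ `IsLocSmooth`).  Proof:
test against the indicator of a small compact open `W ∋ x` (★ `exists_isCompact_isOpen_mem_subset`, ★ `isLocSmooth_indicator`), `0 < μ(W) < ∞`.
[cite: Rogawski1990, §1.6 pp. 5–6; §12.5 p. 182] -/
theorem eq_of_locallyConstantAt_of_integral_eq (μ : Measure X) [IsFiniteMeasureOnCompacts μ] [μ.IsOpenPosMeasure]
    {F U : X → ℂ} {x : X} (hF : ∀ᶠ y in 𝓝 x, F y = F x) (hU : ∀ᶠ y in 𝓝 x, U y = U x)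
    (hint : ∀ φ : X → ℂ, IsLocSmooth φ → ∫ y, φ y * F y ∂μ = ∫ y, φ y * U y ∂μ) :
    F x = U x := by
  -- (1) an open `O ∋ x` on which `F ≡ F x` and `U ≡ U x`, and a compact open `W ∋ x` inside it
  obtain ⟨O, hO, hOo, hxO⟩ := eventually_nhds_iff.1 (hF.and hU)
  obtain ⟨W, hWc, hWo, hxW, hWO⟩ := Literature.Topology.exists_isCompact_isOpen_mem_subset hOo hxO
  have hWm : MeasurableSet W := hWo.measurableSet
  -- (2) the test function `𝟙_W ∈ C_c^∞(X)` and the two integrals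
  have hφ : IsLocSmooth (W.indicator fun _ => (1 : ℂ)) := isLocSmooth_indicator hWo hWc.isClosed hWc
  have hA : ∫ y, W.indicator (fun _ => (1 : ℂ)) y * F y ∂μ = μ.real W • F x := by
    have hfun : (fun y => W.indicator (fun _ => (1 : ℂ)) y * F y) = W.indicator fun _ => F x := by
      funext y
      by_cases hy : y ∈ W
      · rw [Set.indicator_of_mem hy, Set.indicator_of_mem hy, one_mul]
        exact (hO y (hWO hy)).1
      · rw [Set.indicator_of_notMem hy, Set.indicator_of_notMem hy, zero_mul]
    rw [hfun, integral_indicator_const _ hWm]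
  have hB : ∫ y, W.indicator (fun _ => (1 : ℂ)) y * U y ∂μ = μ.real W • U x := by
    have hfun : (fun y => W.indicator (fun _ => (1 : ℂ)) y * U y) = W.indicator fun _ => U x := by
      funext y
      by_cases hy : y ∈ W
      · rw [Set.indicator_of_mem hy, Set.indicator_of_mem hy, one_mul]
        exact (hO y (hWO hy)).2
      · rw [Set.indicator_of_notMem hy, Set.indicator_of_notMem hy, zero_mul]
    rw [hfun, integral_indicator_const _ hWm]
  -- (3) cancel `μ(W) ∈ (0, ∞)`
  have hWpos : μ.real W ≠ 0 := by
    intro h0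
    have h0' : μ W = 0 := (measureReal_eq_zero_iff hWc.measure_lt_top.ne).1 h0
    exact (hWo.measure_pos μ ⟨x, hxW⟩).ne' h0'
  have hAB := hint _ hφ
  rw [hA, hB] at hAB
  exact smul_right_injective ℂ hWpos hAB

/-- **Set version.**  Two densities locally constant at every point of `R ⊆ X` with the same integrals against `C_c^∞(X)` agree ON `R` (pointwise).
[cite: Rogawski1990, §1.6 pp. 5–6; §12.5 p. 182] -/
theorem eqOn_of_locallyConstantOn_of_integral_eq (μ : Measure X) [IsFiniteMeasureOnCompacts μ] [μ.IsOpenPosMeasure]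
    {R : Set X} {F U : X → ℂ} (hF : ∀ x ∈ R, ∀ᶠ y in 𝓝 x, F y = F x) (hU : ∀ x ∈ R, ∀ᶠ y in 𝓝 x, U y = U x)
    (hint : ∀ φ : X → ℂ, IsLocSmooth φ → ∫ y, φ y * F y ∂μ = ∫ y, φ y * U y ∂μ) :
    Set.EqOn F U R :=
  fun _ hx => eq_of_locallyConstantAt_of_integral_eq μ (hF _ hx) (hU _ hx) hint

end Density

/-! ## §2 (DENS) `EllipticData.WeylDensity` derived: pointwise on `G^r`, hence `dγ`-a.e. on every elliptic Cartan representative a.e. contained in `G^r` -/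

section Dens

variable {G H : Type} [Group G] [TopologicalSpace G] [IsTopologicalGroup G] [MeasurableSpace G]
  [∀ γ : G, MeasurableSpace (G ⧸ Subgroup.centralizer ({γ} : Set G))] [MeasurableSpace (G ⧸ Subgroup.center G)]
  [Group H] [TopologicalSpace H] [IsTopologicalGroup H] [MeasurableSpace H]

/-- **(DENS) from a.e.-regularity of the elliptic Cartan representatives.**  `G` locally compact Hausdorff totally disconnected with Borel σ-algebra, `𝔇` a §12.5 datum
whose `dg = 𝔇.μG` is finite on compacts and positive on opens (any Haar measure).  If on every `T ∈ cartanG` `dγ`-almost every `γ` lies in `G^r = 𝔇.regG`, then ★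
`𝔇.WeylDensity` holds: two measurable locally integrable functions locally constant on `G^r` with equal integrals against `C_c^∞(G)` agree at every point of `G^r` (§1),
hence `dγ`-a.e. on each `T`.  (Measurability ∕ local integrability are not even used.) [cite: Rogawski1990, §12.5 p. 182; p. 184] -/
theorem weylDensity_of_ae_mem_regG [BorelSpace G] [LocallyCompactSpace G] [T2Space G] [TotallyDisconnectedSpace G]
    (𝔇 : Ch12Sec5.EllipticData G H) [IsFiniteMeasureOnCompacts 𝔇.μG] [𝔇.μG.IsOpenPosMeasure]
    (hTreg : ∀ T ∈ 𝔇.cartanG, ∀ᵐ t : ↥T ∂(𝔇.μT T), (t : G) ∈ 𝔇.regG) :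
    𝔇.WeylDensity := by
  intro F U _ _ _ _ hFlc hUlc hint T hT
  filter_upwards [hTreg T hT] with t ht
  exact eq_of_locallyConstantAt_of_integral_eq 𝔇.μG (hFlc _ ht) (hUlc _ ht) hint

/-- **(DENS) from (C2) ★ `EllCartanAE` and «`G^e ⊆ G^r`».**  Same setting; if `dγ`-a.e. `γ ∈ T` is elliptic regular for every `T ∈ cartanG` ((C2), print p. 184) and
`𝔇.ellG ⊆ 𝔇.regG` (print p. 184: «`G^e ⊆ G^r`»), then ★ `𝔇.WeylDensity`. [cite: Rogawski1990, §12.5 p. 182; p. 184] -/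
theorem weylDensity_of_ellCartanAE [BorelSpace G] [LocallyCompactSpace G] [T2Space G] [TotallyDisconnectedSpace G]
    (𝔇 : Ch12Sec5.EllipticData G H) [IsFiniteMeasureOnCompacts 𝔇.μG] [𝔇.μG.IsOpenPosMeasure]
    (hC2 : 𝔇.EllCartanAE) (hER : 𝔇.ellG ⊆ 𝔇.regG) :
    𝔇.WeylDensity :=
  weylDensity_of_ae_mem_regG 𝔇 fun T hT => (hC2 T hT).mono fun _ ht => hER ht

/-- **Pointwise form on `G^r`** (what the proof actually gives, with no hypothesis on the Cartan data): under the hypotheses of ★ `WeylDensity` the two functions agree at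
EVERY point of `𝔇.regG`. [cite: Rogawski1990, §12.5 p. 182] -/
theorem eqOn_regG_of_integral_eq [BorelSpace G] [LocallyCompactSpace G] [T2Space G] [TotallyDisconnectedSpace G]
    (𝔇 : Ch12Sec5.EllipticData G H) [IsFiniteMeasureOnCompacts 𝔇.μG] [𝔇.μG.IsOpenPosMeasure]
    {F U : G → ℂ} (hFlc : ∀ x ∈ 𝔇.regG, ∀ᶠ y in 𝓝 x, F y = F x) (hUlc : ∀ x ∈ 𝔇.regG, ∀ᶠ y in 𝓝 x, U y = U x)
    (hint : ∀ φ : G → ℂ, IsLocSmooth φ → ∫ y, φ y * F y ∂𝔇.μG = ∫ y, φ y * U y ∂𝔇.μG) :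
    Set.EqOn F U 𝔇.regG :=
  eqOn_of_locallyConstantOn_of_integral_eq 𝔇.μG hFlc hUlc hint

end Dens

/-! ## §2′ The organ instance: `U(Φ₃)(L⁺_v)` with the organ's Haar measure `νQv = 𝔇.μG` -/

section DensOrgan

variable (L : Type) [Field L] [NumberField L] [IsCMField L]

/-- **(DENS) on the quasi-split model.**  On `Gqs L v = U(Φ₃)(L⁺_v)` (locally compact, Hausdorff, totally disconnected — ★ instances of `LocalUnitaryGroupCongrMeasure` ∕ ★
`totallyDisconnectedSpace_cmDatum_local`) with a Haar measure `νQv` over a binder-supplied Borel structure: for every §12.5 datum `𝔇 : EllipticData (Gqs L v) H` with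
`𝔇.μG = νQv` whose elliptic Cartan representatives are `dγ`-a.e. regular, ★ `𝔇.WeylDensity` holds. [cite: Rogawski1990, §12.5 p. 182; p. 184] -/
theorem weylDensity_gqs_of_ae_mem_regG (v : HeightOneSpectrum (𝓞 ↥(maximalRealSubfield L)))
    [MeasurableSpace (Gqs L v)] [BorelSpace (Gqs L v)]
    [∀ γ : Gqs L v, MeasurableSpace (Gqs L v ⧸ Subgroup.centralizer ({γ} : Set (Gqs L v)))] [MeasurableSpace (Gqs L v ⧸ Subgroup.center (Gqs L v))]
    {H : Type} [Group H] [TopologicalSpace H] [IsTopologicalGroup H] [MeasurableSpace H]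
    (νQv : Measure (Gqs L v)) [νQv.IsHaarMeasure]
    (𝔇 : Ch12Sec5.EllipticData (Gqs L v) H) (hμG : 𝔇.μG = νQv)
    (hTreg : ∀ T ∈ 𝔇.cartanG, ∀ᵐ t : ↥T ∂(𝔇.μT T), (t : Gqs L v) ∈ 𝔇.regG) :
    𝔇.WeylDensity := by
  haveI : TotallyDisconnectedSpace (Gqs L v) := totallyDisconnectedSpace_cmDatum_local L 3 (qsForm L) v
  haveI : IsFiniteMeasureOnCompacts 𝔇.μG := hμG ▸ inferInstance
  haveI : 𝔇.μG.IsOpenPosMeasure := hμG ▸ inferInstance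
  exact weylDensity_of_ae_mem_regG 𝔇 hTreg

/-- **(DENS) on the quasi-split model from (C2) ★ `EllCartanAE` and «(E⊆R) `𝔇.ellG ⊆ 𝔇.regG`»** — the form the leaf consumes: at the (S-b1)∕(S-b2) calls the binder
`hDens` becomes `weylDensity_gqs_of_ellCartanAE L v νQv 𝔇 hμG hTell hER`. [cite: Rogawski1990, §12.5 p. 182; p. 184] -/
theorem weylDensity_gqs_of_ellCartanAE (v : HeightOneSpectrum (𝓞 ↥(maximalRealSubfield L)))
    [MeasurableSpace (Gqs L v)] [BorelSpace (Gqs L v)]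
    [∀ γ : Gqs L v, MeasurableSpace (Gqs L v ⧸ Subgroup.centralizer ({γ} : Set (Gqs L v)))] [MeasurableSpace (Gqs L v ⧸ Subgroup.center (Gqs L v))]
    {H : Type} [Group H] [TopologicalSpace H] [IsTopologicalGroup H] [MeasurableSpace H]
    (νQv : Measure (Gqs L v)) [νQv.IsHaarMeasure]
    (𝔇 : Ch12Sec5.EllipticData (Gqs L v) H) (hμG : 𝔇.μG = νQv)
    (hC2 : 𝔇.EllCartanAE) (hER : 𝔇.ellG ⊆ 𝔇.regG) :
    𝔇.WeylDensity :=
  weylDensity_gqs_of_ae_mem_regG L v νQv 𝔇 hμG fun T hT => (hC2 T hT).mono fun _ ht => hER ht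

end DensOrgan

/-! ## §3 (LDSE) `EllipticData.LdsElliptic` derived from ★ `Ch12Sec6.Prop1261c`, (LDS2) `LdsCardTwo` and (C2) `EllCartanAE` -/

section Ldse

variable {G H : Type} [Group G] [TopologicalSpace G] [IsTopologicalGroup G] [MeasurableSpace G]
  [∀ γ : G, MeasurableSpace (G ⧸ Subgroup.centralizer ({γ} : Set G))] [MeasurableSpace (G ⧸ Subgroup.center G)]
  [Group H] [TopologicalSpace H] [IsTopologicalGroup H] [MeasurableSpace H]
  (𝔇 : Ch12Sec5.EllipticData G H)

/-- **`⟨χ_π, β⟩_{G,e} ≠ 0 ⇒ π` is elliptic** (★ `IsEllipticRep`: `χ_π` does not vanish identically on `G^e`), under (C2) — the contrapositive of ★ «SC-FIN»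
`innerG_eq_zero_of_not_isEllipticRep` (LH6-p05). [cite: Rogawski1990, §12.6 p. 187; §12.5 p. 184] -/
theorem isEllipticRep_of_innerG_ne_zero (hC2 : 𝔇.EllCartanAE) {π : IrrClass G} (β : G → ℂ) (h : 𝔇.innerG (𝔇.char π) β ≠ 0) :
    𝔇.IsEllipticRep π := by
  by_contra hne
  exact h (F0P3cStCharTSScFin.innerG_eq_zero_of_not_isEllipticRep 𝔇 hC2 hne β)

/-- **Both members of a pair of one of the three kinds are elliptic** — from ★ `Ch12Sec6.Prop1261c` (`⟨χ_π, χ_{π′}⟩_e = −1` for `π ≠ π′` of one of the three kinds, no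
ellipticity hypothesis) and (C2).  Print p. 187: «All representations of this type are in fact elliptic». [cite: Rogawski1990, §12.6 Prop. 12.6.1 (c) p. 188; p. 187] -/
theorem isEllipticRep_of_isEllipticPair (h61c : Ch12Sec6.Prop1261c 𝔇) (hC2 : 𝔇.EllCartanAE)
    {π π' : IrrClass G} (hne : π ≠ π') (hpair : 𝔇.IsEllipticPair π π') :
    𝔇.IsEllipticRep π ∧ 𝔇.IsEllipticRep π' := by
  refine ⟨isEllipticRep_of_innerG_ne_zero 𝔇 hC2 (𝔇.char π') ?_, isEllipticRep_of_innerG_ne_zero 𝔇 hC2 (𝔇.char π) ?_⟩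
  · rw [h61c π π' hne hpair]; norm_num
  · rw [h61c π' π hne.symm (F0P3cStCharTSSaRegroupKinds.isEllipticPair_symm 𝔇 hpair)]; norm_num

/-- **An l.d.s. `L`-packet with exactly two members is a pair of the first kind**: for `Π ∈ ldsPackets` and `σ ∈ Π`, (LDS2) ★ `LdsCardTwo` provides the partner
`σ′ ≠ σ` with `Π = {σ, σ′}`, i.e. ★ `IsEllipticPair σ σ′`. [cite: Rogawski1990, §12.2 (3) p. 174; §12.6 Prop. 12.6.1 (b) p. 188] -/
theorem exists_partner_isEllipticPair_of_ldsCardTwo (hLds2 : 𝔇.LdsCardTwo) {P : Finset (IrrClass G)} (hP : P ∈ 𝔇.ldsPackets)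
    {σ : IrrClass G} (hσ : σ ∈ P) :
    ∃ σ' ∈ P, σ' ≠ σ ∧ 𝔇.IsEllipticPair σ σ' := by
  obtain ⟨σ', hσ'P, hne, hall⟩ := hLds2 P hP σ hσ
  refine ⟨σ', hσ'P, hne, Or.inl ⟨P, hP, fun τ => ⟨fun hτ => hall τ hτ, fun h => ?_⟩⟩⟩
  rcases h with rfl | rfl
  · exact hσ
  · exact hσ'P

/-- **(LDSE) ★ `EllipticData.LdsElliptic` DERIVED: every member of an l.d.s. `L`-packet is elliptic**, from ★ `Ch12Sec6.Prop1261c` [Prop. 12.6.1 (c)], (LDS2) ★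
`LdsCardTwo` and (C2) ★ `EllCartanAE`.  At the leaf's (S-a) call the binder `hLdsE` becomes `ldsElliptic_of_prop1261c 𝔇 h61c hLds2 hTell`.
[cite: Rogawski1990, §12.6 Prop. 12.6.1 (c) p. 188; p. 187; §12.2 (3) p. 174; §12.5 p. 184] -/
theorem ldsElliptic_of_prop1261c (h61c : Ch12Sec6.Prop1261c 𝔇) (hLds2 : 𝔇.LdsCardTwo) (hC2 : 𝔇.EllCartanAE) :
    𝔇.LdsElliptic := by
  intro P hP σ hσ
  obtain ⟨σ', -, hne, hpair⟩ := exists_partner_isEllipticPair_of_ldsCardTwo 𝔇 hLds2 hP hσ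
  exact (isEllipticRep_of_isEllipticPair 𝔇 h61c hC2 hne.symm hpair).1

end Ldse

/-! ## §4 The `G`-half of (DEF) `EllipticData.PacketInnerDefined` derived from (U2) `L2UpOnTorus` (Cauchy–Schwarz, ★ «ELL-LIN») -/

section Def

variable {G H : Type} [Group G] [TopologicalSpace G] [IsTopologicalGroup G] [MeasurableSpace G]
  [∀ γ : G, MeasurableSpace (G ⧸ Subgroup.centralizer ({γ} : Set G))] [MeasurableSpace (G ⧸ Subgroup.center G)]
  [Group H] [TopologicalSpace H] [IsTopologicalGroup H] [MeasurableSpace H]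
  (𝔇 : Ch12Sec5.EllipticData G H)

/-- **`⟨α, β⟩_{G,e}` converges on the `L²(D_G)` domain**: if `D_G α` and `D_G β` are square-integrable on every elliptic Cartan representative, ★ `InnerGDefined α β`
(★ «ELL-LIN» `integrable_innerG_integrand`: `D_G² α \overline{β} = (D_G α)\overline{(D_G β)}`, Cauchy–Schwarz). [cite: Rogawski1990, §12.5 p. 184] -/
theorem innerGDefined_of_memLp {α β : G → ℂ}
    (hα : ∀ T ∈ 𝔇.cartanG, MemLp (fun t : ↥T => (𝔇.DG (t : G) : ℂ) * α (t : G)) 2 (𝔇.μT T))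
    (hβ : ∀ T ∈ 𝔇.cartanG, MemLp (fun t : ↥T => (𝔇.DG (t : G) : ℂ) * β (t : G)) 2 (𝔇.μT T)) :
    𝔇.InnerGDefined α β :=
  fun T hT => F0P3cStCharTSEllLin.integrable_innerG_integrand 𝔇 (hα T hT) (hβ T hT)

/-- **The `G`-half of (DEF) from (U2)**: `⟨χ_ρ^G, χ_ρ^G⟩_{G,e}` converges for every `ρ ∈ Π²(H)` as soon as `D_G χ_ρ^G ∈ L²(T, dγ)` on every elliptic Cartan
representative (★ `L2UpOnTorus`, print p. 193 «bounded elliptic norm»). [cite: Rogawski1990, §12.5 p. 184; §12.7 Lemma 12.7.2 (proof) p. 193] -/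
theorem innerGDefined_up_of_l2UpOnTorus (hU2 : 𝔇.L2UpOnTorus) :
    ∀ ρ ∈ 𝔇.sqPacketsH, 𝔇.InnerGDefined (𝔇.up (𝔇.packetCharH ρ)) (𝔇.up (𝔇.packetCharH ρ)) :=
  fun ρ hρ => innerGDefined_of_memLp 𝔇 (hU2 ρ hρ) (hU2 ρ hρ)

/-- **`⟨χ_π, χ_{π′}⟩_{G,e}` converges for all classes** from (L2D∀) ★ `L2CharOnTorusAll`. [cite: Rogawski1990, §12.5 p. 184; §12.6 Prop. 12.6.1 pp. 187–188] -/
theorem innerGDefined_char_of_l2CharOnTorusAll (hL2 : 𝔇.L2CharOnTorusAll) (π π' : IrrClass G) :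
    𝔇.InnerGDefined (𝔇.char π) (𝔇.char π') :=
  innerGDefined_of_memLp 𝔇 (hL2 π) (hL2 π')

/-- **`⟨χ_π, χ_ρ^G⟩_{G,e}` converges** for every class `π` and every `ρ ∈ Π²(H)`, from (L2D∀) and (U2). [cite: Rogawski1990, §12.5 p. 184; Cor. 12.5.4 p. 186] -/
theorem innerGDefined_char_up_of_l2 (hL2 : 𝔇.L2CharOnTorusAll) (hU2 : 𝔇.L2UpOnTorus) (π : IrrClass G) :
    ∀ ρ ∈ 𝔇.sqPacketsH, 𝔇.InnerGDefined (𝔇.char π) (𝔇.up (𝔇.packetCharH ρ)) :=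
  fun ρ hρ => innerGDefined_of_memLp 𝔇 (hL2 π) (hU2 ρ hρ)

/-- **(DEF) ⟸ (U2) ∧ (DEF-H)**: ★ `PacketInnerDefined` from (U2) ★ `L2UpOnTorus` and its own `H`-half «`⟨χ_ρ, χ_ρ⟩_{H,e}` converges for `ρ ∈ Π²(H)`» — the
re-lettered socket (DEF-H) a later leaf edition keeps.  At the (S-b1)∕(S-b2) calls the binder `hDef` becomes
`packetInnerDefined_of_l2UpOnTorus_of_innerHDefined 𝔇 hUdom hDefH`. [cite: Rogawski1990, §12.5 p. 184; Prop. 12.5.2 p. 185] -/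
theorem packetInnerDefined_of_l2UpOnTorus_of_innerHDefined (hU2 : 𝔇.L2UpOnTorus)
    (hDefH : ∀ ρ ∈ 𝔇.sqPacketsH, 𝔇.InnerHDefined (𝔇.packetCharH ρ) (𝔇.packetCharH ρ)) :
    𝔇.PacketInnerDefined :=
  fun ρ hρ => ⟨innerGDefined_up_of_l2UpOnTorus 𝔇 hU2 ρ hρ, hDefH ρ hρ⟩

end Def

/-! ## §5 (M1H)'s «stable class function on `H^e`» clause derived from its `H^r` clause and «`H^e ⊆ H^r`» -/

section M1H

variable {G H : Type} [Group G] [TopologicalSpace G] [IsTopologicalGroup G] [MeasurableSpace G]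
  [∀ γ : G, MeasurableSpace (G ⧸ Subgroup.centralizer ({γ} : Set G))] [MeasurableSpace (G ⧸ Subgroup.center G)]
  [Group H] [TopologicalSpace H] [IsTopologicalGroup H] [MeasurableSpace H]

/-- ★ `IsClassFunOn` is antitone in the set. [cite: Rogawski1990, §12.5 p. 184] -/
theorem isClassFunOn_mono {K : Type} [Group K] {S S' : Set K} (hSS' : S ⊆ S') {α : K → ℂ} (h : Ch12Sec5.IsClassFunOn S' α) :
    Ch12Sec5.IsClassFunOn S α :=
  fun γ hγ x => h γ (hSS' hγ) x

/-- ★ `IsStableClassFunOn` is antitone in the set. [cite: Rogawski1990, §12.5 p. 182] -/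
theorem isStableClassFunOn_mono {K : Type} [Group K] {st : K → K → Prop} {S S' : Set K} (hSS' : S ⊆ S') {α : K → ℂ}
    (h : Ch12Sec5.IsStableClassFunOn st S' α) : Ch12Sec5.IsStableClassFunOn st S α :=
  ⟨isClassFunOn_mono hSS' h.1, fun γ hγ γ' hst => h.2 γ (hSS' hγ) γ' hst⟩

/-- **(M1H) ⟸ (M1H without its `H^e` clause) ∧ «(E⊆R)_H `𝔇.ellH ⊆ 𝔇.regH`»**: the fourth conjunct «`χ_ρ` is a stable class function on `H^e`» of ★
`PacketCharHRegularity` follows from the third («… on `H^r`») once `H^e ⊆ H^r` (print p. 184, definition-level).  A later leaf edition may re-letter (M1H) to the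
four-clause form below plus the coherence (E⊆R)_H. [cite: Rogawski1990, §1.6 pp. 5–6; §12.5 pp. 183–184] -/
theorem packetCharHRegularity_of_regH (𝔇 : Ch12Sec5.EllipticData G H) (hEHR : 𝔇.ellH ⊆ 𝔇.regH)
    (h : ∀ ρ ∈ 𝔇.sqPacketsH, Measurable (𝔇.packetCharH ρ) ∧ LocallyIntegrable (𝔇.packetCharH ρ) 𝔇.μH ∧
      Ch12Sec5.IsStableClassFunOn 𝔇.stConjH 𝔇.regH (𝔇.packetCharH ρ) ∧
      ∀ fH : H → ℂ, IsLocSmooth fH → (∑ σ ∈ ρ, σ.smoothTrace 𝔇.μH fH) = ∫ h, fH h * 𝔇.packetCharH ρ h ∂𝔇.μH) :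
    𝔇.PacketCharHRegularity := by
  intro ρ hρ
  obtain ⟨hm, hli, hst, htr⟩ := h ρ hρ
  exact ⟨hm, hli, hst, isStableClassFunOn_mono hEHR hst, htr⟩

end M1H

end Summit.HodgeConjecture.HodgeConjecture.Cruxes.H413.F0P3cStCharTSSocketsOut

end
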